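import Mathlib
import HarnessLib
import HarnessLib.Audit
import Summits.CriticalPhenomena.PercolationContinuityZ3.Theorems.PercNearOneGluingNoHeavyLowerTailHexMSMatchBlockCount
import Summits.CriticalPhenomena.PercolationContinuityZ3.Theorems.PercNearOneGluingNoHeavyLowerTailHexMSMatchMS2Instance

/-!
# (Π2″) and (MATCH*) from the block-counting criterion (hp-7 gen 78)

Support file for crux `stmt-CriticalPhenomena-4575` (route `PercNearOneGluingNoHeavy`), hull-port seat `prim-hp-7` (generation 78);
`--supports stmt-CriticalPhenomena-4575 --as helper`.  No `sorry`.  Memo: `run/shared/lean/prim/prim-hp-7/FROM-prim-hp-7-g78-RECTANGLES-AND-REDUCTIONS.md` §7–8.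

`BlockCount.ms2_of_blockCount` proves (MS2) for an instance `(P, Q, D₅, D₂)` from one counting condition: the designated sets are at most as numerous
as the pure one-way cross differences `C₅ = (P \\ Q) \ (Q \\ P ∪ P \\ P ∪ Q \\ Q)` plus the new second differences (and no `q ⊆ p`).  Pushed through the
gen-76 instance bridges this gives a (MATCH*) theorem whose only extra hypotheses are that counting condition for the derived instance and the absence
of containments from the label-`i+1` dead class into the label-`i` dead class; numerically it covers 91–97 % of random depth-one two-type configurations
(n = 6, 7, 8; memo §8), against ≈ 72 % for the common-element bridge.

* `two_mul_card_le_card_clU_scTerms_of_blockCount` — (Π2″) for dead-like blocks with complement-free blocker representatives under the counting condition (purity is NOT needed);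
* `card_le_card_farNbhd_of_blockCount` — Hall for the dead set of a depth-one saturated two-class antipodal instance under the counting condition.
-/

namespace Summit.CriticalPhenomena.PercolationContinuityZ3.Theorems

namespace GeneratedDonors

open Finset FinsetFamily

variable {α : Type*} [DecidableEq α] {U : Finset α}

/-- **(Π2″) for dead-like blocks under the block-counting criterion** (hp-7 gen 78). -/
theorem two_mul_card_le_card_clU_scTerms_of_blockCount (P Q W : Finset (Finset α))
    (hU : ∀ a ∈ P ∪ Q, a ⊆ U) (hPQ : Disjoint P Q)
    (hint : ∀ a ∈ P ∪ Q, ∀ b ∈ P ∪ Q, (a ∩ b).Nonempty) (hcov : ∀ a ∈ P ∪ Q, ∀ b ∈ P ∪ Q, a ∪ b ≠ U)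
    (hrep : W ⊆ scReps U P Q) (hWco : ∀ a ∈ W, ∀ b ∈ W, a ≠ U \ b)
    (hcont : ∀ q ∈ Q, ∀ p ∈ P, ¬ q ⊆ p)
    (hcount : #(((P \\ Q).filter fun d => d ∈ W) ∪ ((Q \\ P).filter fun d => U \ d ∈ W)) ≤
      #(((P \\ Q) \ ((Q \\ P) ∪ (P \\ P) ∪ (Q \\ Q))) ∪
        (((P \\ ((P \\ Q).filter fun d => d ∈ W)) ∪ (Q \\ ((Q \\ P).filter fun d => U \ d ∈ W))) \ ((P ∪ Q) \\ (P ∪ Q))))) :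
    2 * (#P + #Q + #W) ≤ #(clU U (scTerms P Q W)) := by
  classical
  refine two_mul_card_le_card_clU_scTerms_of_ms2At P Q W hU hPQ hint hcov hrep hWco ?_
  exact BlockCount.ms2_of_blockCount P Q _ _ hPQ (filter_subset _ _) (filter_subset _ _) hcont hcount

section DepthOne

variable {𝒟 : Finset (Finset α)} {x : Finset α → ZMod 6}

/-- **(MATCH*) for a depth-one saturated two-class instance under the block-counting criterion** (hp-7 gen 78): as
`card_le_card_farNbhd_of_ms2At`, with the instance inequality supplied by `BlockCount.ms2_of_blockCount` — hypotheses: no dead member of label `i+1`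
is contained in a dead member of label `i`, and the derived designated sets are at most as numerous as the pure one-way cross differences of the two dead
classes plus their new second differences. -/
theorem card_le_card_farNbhd_of_blockCount (hU : ∀ a ∈ 𝒟, a ⊆ U) (hco : ∀ a ∈ 𝒟, U \ a ∈ 𝒟)
    (hanti : ∀ a ∈ 𝒟, x (U \ a) = x a + 3) (i : ZMod 6)
    (hlab : ∀ a ∈ dead U 𝒟 x, x a = i ∨ x a = i + 1 ∨ x a = i + 3 ∨ x a = i + 4)
    (hdepth : ∀ d ∈ 𝒟, d ∉ dead U 𝒟 x →
      (x d = i + 5 ∧ d ∈ scReps U ((dead U 𝒟 x).filter fun a => x a = i) ((dead U 𝒟 x).filter fun a => x a = i + 1)) ∨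
      (x d = i + 2 ∧ U \ d ∈ scReps U ((dead U 𝒟 x).filter fun a => x a = i) ((dead U 𝒟 x).filter fun a => x a = i + 1)))
    (hcont : ∀ q ∈ dead U 𝒟 x, ∀ p ∈ dead U 𝒟 x, x q = i + 1 → x p = i → ¬ q ⊆ p)
    (hcount : #(((((dead U 𝒟 x).filter fun a => x a = i) \\ ((dead U 𝒟 x).filter fun a => x a = i + 1)).filter fun d => d ∈ ((𝒟 \ dead U 𝒟 x).filter fun a => x a = i + 5)) ∪ ((((dead U 𝒟 x).filter fun a => x a = i + 1) \\ ((dead U 𝒟 x).filter fun a => x a = i)).filter fun d => U \ d ∈ ((𝒟 \ dead U 𝒟 x).filter fun a => x a = i + 5))) ≤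
      #(((((dead U 𝒟 x).filter fun a => x a = i) \\ ((dead U 𝒟 x).filter fun a => x a = i + 1)) \ ((((dead U 𝒟 x).filter fun a => x a = i + 1) \\ ((dead U 𝒟 x).filter fun a => x a = i)) ∪ (((dead U 𝒟 x).filter fun a => x a = i) \\ ((dead U 𝒟 x).filter fun a => x a = i)) ∪ (((dead U 𝒟 x).filter fun a => x a = i + 1) \\ ((dead U 𝒟 x).filter fun a => x a = i + 1)))) ∪
        (((((dead U 𝒟 x).filter fun a => x a = i) \\ ((((dead U 𝒟 x).filter fun a => x a = i) \\ ((dead U 𝒟 x).filter fun a => x a = i + 1)).filter fun d => d ∈ ((𝒟 \ dead U 𝒟 x).filter fun a => x a = i + 5))) ∪ (((dead U 𝒟 x).filter fun a => x a = i + 1) \\ ((((dead U 𝒟 x).filter fun a => x a = i + 1) \\ ((dead U 𝒟 x).filter fun a => x a = i)).filter fun d => U \ d ∈ ((𝒟 \ dead U 𝒟 x).filter fun a => x a = i + 5)))) \ ((((dead U 𝒟 x).filter fun a => x a = i) ∪ ((dead U 𝒟 x).filter fun a => x a = i + 1)) \\ (((dead U 𝒟 x).filter fun a => x a = i) ∪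 ((dead U 𝒟 x).filter fun a => x a = i + 1)))))) :
    #𝒟 ≤ #(farNbhd 𝒟 x (dead U 𝒟 x)) := by
  classical
  obtain ⟨n01, n30, n31, n40, n41, n85, n50, n51, n20, n21, n25, n53, n54, e33, e43, e23⟩ := label_facts i
  set P : Finset (Finset α) := (dead U 𝒟 x).filter fun a => x a = i with hPdef
  set Q : Finset (Finset α) := (dead U 𝒟 x).filter fun a => x a = i + 1 with hQdef
  set W : Finset (Finset α) := (𝒟 \ dead U 𝒟 x).filter fun a => x a = i + 5 with hWdef
  have hP : ∀ p ∈ P, p ∈ dead U 𝒟 x ∧ x p = i := fun p hp => by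
    have h := mem_filter.mp hp; exact ⟨h.1, h.2⟩
  have hQ : ∀ q ∈ Q, q ∈ dead U 𝒟 x ∧ x q = i + 1 := fun q hq => by
    have h := mem_filter.mp hq; exact ⟨h.1, h.2⟩
  have hW : ∀ w ∈ W, (w ∈ 𝒟 ∧ w ∉ dead U 𝒟 x) ∧ x w = i + 5 := fun w hw => by
    have h := mem_filter.mp hw; exact ⟨mem_sdiff.mp h.1, h.2⟩
  have hdD : ∀ {a}, a ∈ dead U 𝒟 x → a ∈ 𝒟 := fun ha => (mem_filter.mp ha).1
  have hcc : ∀ {a}, a ⊆ U → U \ (U \ a) = a := fun ha => Finset.sdiff_sdiff_eq_self ha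
  -- the hypotheses of the pure inequality for (P, Q, W)
  have h1 : ∀ a ∈ P ∪ Q, a ⊆ U := by
    intro a ha
    rcases mem_union.mp ha with ha | ha
    · exact hU a (hdD (hP a ha).1)
    · exact hU a (hdD (hQ a ha).1)
  have h2 : Disjoint P Q := by
    rw [Finset.disjoint_left]
    intro a haP haQ
    exact n01 ((hP a haP).2.symm.trans (hQ a haQ).2)
  have hPQlab : ∀ a ∈ P ∪ Q, a ∈ dead U 𝒟 x ∧ (x a = i ∨ x a = i + 1) := by
    intro a ha
    rcases mem_union.mp ha with ha | ha
    · exact ⟨(hP a ha).1, Or.inl (hP a ha).2⟩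
    · exact ⟨(hQ a ha).1, Or.inr (hQ a ha).2⟩
  -- dead-like: pairwise intersecting and non-covering (labels i, i+1 are close)
  have hint : ∀ a ∈ P ∪ Q, ∀ b ∈ P ∪ Q, (a ∩ b).Nonempty := fun a ha b hb =>
    inter_nonempty_of_dead_of_close (hPQlab a ha).1 (hdD (hPQlab b hb).1)
      (close_of_mem_pair (hPQlab a ha).2 (hPQlab b hb).2)
  have hcov : ∀ a ∈ P ∪ Q, ∀ b ∈ P ∪ Q, a ∪ b ≠ U := fun a ha b hb =>
    union_ne_of_dead_of_close hU hco hanti (hPQlab a ha).1 (hdD (hPQlab b hb).1)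
      (close_of_mem_pair (hPQlab a ha).2 (hPQlab b hb).2)
  have h4 : W ⊆ scReps U P Q := by
    intro w hw
    obtain ⟨⟨hwD, hwa⟩, hxw⟩ := hW w hw
    rcases hdepth w hwD hwa with ⟨-, h⟩ | ⟨h2', -⟩
    · exact h
    · exact absurd (hxw.symm.trans h2') n25.symm
  have h5 : ∀ a ∈ W, ∀ b ∈ W, a ≠ U \ b := by
    intro a ha b hb hab
    have hxa := (hW a ha).2
    have hxb : x a = x b + 3 := by rw [hab]; exact hanti b (hW b hb).1.1
    rw [(hW b hb).2] at hxb
    exact n85 (hxb.symm.trans hxa)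
  have hcont' : ∀ q ∈ Q, ∀ p ∈ P, ¬ q ⊆ p := fun q hq p hp =>
    hcont q (hQ q hq).1 p (hP p hp).1 (hQ q hq).2 (hP p hp).2
  have hineq : 2 * (#P + #Q + #W) ≤ #(clU U (scTerms P Q W)) :=
    two_mul_card_le_card_clU_scTerms_of_blockCount P Q W h1 h2 hint hcov h4 h5 hcont' hcount
  have hsub : clU U (scTerms P Q W) ⊆ farNbhd 𝒟 x (dead U 𝒟 x) :=
    clU_scTerms_subset_farNbhd hU hco hanti i hP hQ (fun w hw => ⟨(hW w hw).1.1, (hW w hw).2⟩)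
  -- counting 𝒟: every member or its complement lies in P ∪ Q ∪ W
  set A : Finset (Finset α) := 𝒟.filter fun d => x d = i ∨ x d = i + 1 ∨ x d = i + 5 with hAdef
  set B : Finset (Finset α) := 𝒟.filter fun d => ¬ (x d = i ∨ x d = i + 1 ∨ x d = i + 5) with hBdef
  have hmemPQW : ∀ d ∈ 𝒟, (x d = i ∨ x d = i + 1 ∨ x d = i + 5) → d ∈ P ∪ Q ∪ W := by
    intro d hd hx
    simp only [mem_union]
    by_cases hdead : d ∈ dead U 𝒟 x
    · rcases hx with h | h | h
      · exact Or.inl (Or.inl (mem_filter.mpr ⟨hdead, h⟩))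
      · exact Or.inl (Or.inr (mem_filter.mpr ⟨hdead, h⟩))
      · exfalso
        rcases hlab d hdead with h' | h' | h' | h'
        · exact n50 (h.symm.trans h')
        · exact n51 (h.symm.trans h')
        · exact n53 (h.symm.trans h')
        · exact n54 (h.symm.trans h')
    · rcases hdepth d hd hdead with ⟨h5', -⟩ | ⟨h2', -⟩
      · exact Or.inr (mem_filter.mpr ⟨mem_sdiff.mpr ⟨hd, hdead⟩, h5'⟩)
      · exfalso
        rcases hx with h | h | h
        · exact n20 (h2'.symm.trans h)
        · exact n21 (h2'.symm.trans h)
        · exact n25 (h2'.symm.trans h)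
  have hA : A ⊆ P ∪ Q ∪ W := fun d hd => hmemPQW d (mem_filter.mp hd).1 (mem_filter.mp hd).2
  have hB : B.image (fun d => U \ d) ⊆ P ∪ Q ∪ W := by
    intro e he
    obtain ⟨d, hd, rfl⟩ := mem_image.mp he
    obtain ⟨hdD', hnot⟩ := mem_filter.mp hd
    refine hmemPQW (U \ d) (hco d hdD') ?_
    rw [hanti d hdD']
    by_cases hdead : d ∈ dead U 𝒟 x
    · rcases hlab d hdead with h | h | h | h
      · exact absurd (Or.inl h) hnot
      · exact absurd (Or.inr (Or.inl h)) hnot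
      · rw [h]; exact Or.inl e33
      · rw [h]; exact Or.inr (Or.inl e43)
    · rcases hdepth d hdD' hdead with ⟨h5', -⟩ | ⟨h2', -⟩
      · exact absurd (Or.inr (Or.inr h5')) hnot
      · rw [h2']; exact Or.inr (Or.inr e23)
  have hinjB : Set.InjOn (fun d : Finset α => U \ d) ↑B := by
    intro d hd e he hde
    have hdU : d ⊆ U := hU d (mem_filter.mp (mem_coe.mp hd)).1
    have heU : e ⊆ U := hU e (mem_filter.mp (mem_coe.mp he)).1
    have h1' := congrArg (fun t => U \ t) hde
    simp only [hcc hdU, hcc heU] at h1'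
    exact h1'
  have hsplit : #A + #B = #𝒟 := card_filter_add_card_filter_not _
  have hcardA : #A ≤ #(P ∪ Q ∪ W) := card_le_card hA
  have hcardB : #B ≤ #(P ∪ Q ∪ W) := by
    rw [← card_image_of_injOn hinjB]; exact card_le_card hB
  have hunion : #(P ∪ Q ∪ W) ≤ #P + #Q + #W :=
    (card_union_le _ _).trans (Nat.add_le_add_right (card_union_le _ _) _)
  have hT := card_le_card hsub
  omega

end DepthOne

end GeneratedDonors

end Summit.CriticalPhenomena.PercolationContinuityZ3.Theorems
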